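import Mathlib
import HarnessLib
import Literature.Analysis.FluidPDE.TypeIAncientMild
import Summits.NavierStokesRegularity.NavierStokesRegularity.Theorems.SymmetryModuliCountSymmetricLiouvilleSelfSimilarLeaf

/-!
# Crux `ForcedSymmetry` (stmt-NavierStokesRegularity-4052), line `blow-down-census`:
# the CONVERGENCE form of the bet — a unique blow-down is self-similar

Route `SymmetryModuliCount`, sub-problem `NavierStokesRegularity`.  Helper file of the lead (gen 2) for the
X-strength stub `stub_blowDownLimitSelfSimilar` ("blow-down limits of elements of `A_C ∩ {ledger}` are annihilated by
the scaling generator").  The card's `UniqueBlowDown` — CONVERGENCE of the whole blow-down family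
`c ↦ c v(t₁ + c² s, x₁ + c y)` as `c → ∞` — is the Łojasiewicz–Simon shape of the bet; this file kernel-checks that it
IMPLIES the registered stub's conclusion, by pure symmetry algebra:

* `smul_apply_of_tendsto_blowDown` — if the full family converges pointwise on `s < 0` to `W`, then `W` is
  invariant under every Leray rescaling about the space–time origin, `m W(m² s, m y) = W(s, y)` (`m > 0`): the
  rescaled family `c ↦ (c m) v(…)` is a tail of the same family;
* `generator_eq_zero_of_smul_apply_eq` — a field jointly smooth on the open slab that is invariant under the
  rescalings is annihilated by the scaling generator `D(W s)(y) y + W s y + 2s ∂ₛW(s, y) = 0` (derivative of the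
  constant orbit at `m = 1`, `hasDerivAt_scalingOrbit`);
* `generator_eq_zero_of_tendsto_blowDown` — the composition, for `W ∈ A_C` (`IsTypeIAncientMild C W`).

So the open content of the stub is exactly the passage from SUBSEQUENTIAL limits (which the landed driver
`stub_blowDownDriver` produces) to limits of the whole family, i.e. uniqueness / asymptotic self-similarity of the
blow-down — the Giga–Kohn / Huisken statement, for which 3-D Navier–Stokes has no monotonicity formula.
-/

noncomputable section

-- the summit and its single problem share the name (D-0017 nested layout)
set_option linter.dupNamespace false

open Set Function Filter Topology
open Literature.Analysis.FluidPDE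
open Summit.NavierStokesRegularity.NavierStokesRegularity.Theorems.SymmetryModuliCountSymmetricLiouville.SelfSimilarLeaf
  (hasDerivAt_scalingOrbit)

namespace Summit.NavierStokesRegularity.NavierStokesRegularity.Theorems.SymmetryModuliCountForcedSymmetry

/-- **A limit of the WHOLE blow-down family is scaling-invariant.**  If `c v(t₁ + c² s, x₁ + c y) → W(s, y)` as
`c → ∞` for every `s < 0` and `y`, then `m W(m² s, m y) = W(s, y)` for all `m > 0`, `s < 0`, `y`: along
`c ↦ c m` the family is `m` times the family evaluated at `(m² s, m y)`. [folklore] -/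
theorem smul_apply_of_tendsto_blowDown
    {v W : ℝ → EuclideanSpace ℝ (Fin 3) → EuclideanSpace ℝ (Fin 3)} {t₁ : ℝ} {x₁ : EuclideanSpace ℝ (Fin 3)}
    (hconv : ∀ s < (0 : ℝ), ∀ y : EuclideanSpace ℝ (Fin 3),
      Tendsto (fun c : ℝ => c • v (t₁ + c ^ 2 * s) (x₁ + c • y)) atTop (𝓝 (W s y)))
    {m : ℝ} (hm : 0 < m) {s : ℝ} (hs : s < 0) (y : EuclideanSpace ℝ (Fin 3)) :
    m • W (m ^ 2 * s) (m • y) = W s y := by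
  have hms : m ^ 2 * s < 0 := mul_neg_of_pos_of_neg (pow_pos hm 2) hs
  -- the family along `c ↦ c * m`
  have h1 : Tendsto (fun c : ℝ => (c * m) • v (t₁ + (c * m) ^ 2 * s) (x₁ + (c * m) • y)) atTop (𝓝 (W s y)) :=
    (hconv s hs y).comp (tendsto_id.atTop_mul_const hm)
  -- the same family is `m •` the family at `(m² s, m y)`
  have h2 : Tendsto (fun c : ℝ => (c * m) • v (t₁ + (c * m) ^ 2 * s) (x₁ + (c * m) • y)) atTop
      (𝓝 (m • W (m ^ 2 * s) (m • y))) := by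
    have h := (hconv (m ^ 2 * s) hms (m • y)).const_smul m
    refine h.congr fun c => ?_
    simp only [smul_smul]
    have e1 : t₁ + c ^ 2 * (m ^ 2 * s) = t₁ + (c * m) ^ 2 * s := by ring
    have e2 : m * c = c * m := mul_comm _ _
    rw [e1, e2]
  exact (tendsto_nhds_unique h2 h1)

/-- **A scaling-invariant field, jointly smooth on the open slab, is annihilated by the scaling generator**:
if `m W(m² s, m y) = W(s, y)` for all `m > 0` (`s < 0`), then `D(W s)(y) y + W s y + 2s ∂ₛW(s, y) = 0` on `s < 0`
— the orbit `m ↦ m W(m² s, m y)` is constant, and its derivative at `m = 1` is the generator clause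
(`hasDerivAt_scalingOrbit`). [folklore] -/
theorem generator_eq_zero_of_smul_apply_eq
    {W : ℝ → EuclideanSpace ℝ (Fin 3) → EuclideanSpace ℝ (Fin 3)}
    (hW : ContDiffOn ℝ (⊤ : ℕ∞) (uncurry W) (Iio 0 ×ˢ univ))
    (hinv : ∀ m : ℝ, 0 < m → ∀ s < (0 : ℝ), ∀ y : EuclideanSpace ℝ (Fin 3), m • W (m ^ 2 * s) (m • y) = W s y) :
    ∀ s < (0 : ℝ), ∀ y : EuclideanSpace ℝ (Fin 3),
      fderiv ℝ (W s) y y + W s y + (2 * s) • timeDeriv W s y = 0 := by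
  intro s hs y
  -- the orbit is constant near `m = 1`, so its derivative there vanishes
  have hconst : (fun m : ℝ => m • W (m ^ 2 * s) (m • y)) =ᶠ[𝓝 1] fun _ => W s y := by
    filter_upwards [Ioi_mem_nhds (zero_lt_one : (0 : ℝ) < 1)] with m hm
    exact hinv m hm s hs y
  have h0 : HasDerivAt (fun m : ℝ => m • W (m ^ 2 * s) (m • y)) 0 1 :=
    (hasDerivAt_const (1 : ℝ) (W s y)).congr_of_eventuallyEq hconst
  -- and it is the generator clause at `(1² s, 1 • y) = (s, y)`
  have h1 := hasDerivAt_scalingOrbit hW hs y (zero_lt_one : (0 : ℝ) < 1)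
  have key := h1.unique h0
  simpa using key

/-- **UniqueBlowDown ⇒ the bet.**  If the whole blow-down family `c v(t₁ + c² s, x₁ + c y)` of a field `v` converges
pointwise on `s < 0`, as `c → ∞`, to an element `W` of the Type-I ancient mild class `A_C`, then `W` is annihilated
by the scaling generator about the space–time origin — the conclusion of the registered X-strength stub
`stub_blowDownLimitSelfSimilar` of the line `blow-down-census`, which assumes only SUBSEQUENTIAL convergence.
[folklore] -/
theorem generator_eq_zero_of_tendsto_blowDown {C : ℝ}
    {v W : ℝ → EuclideanSpace ℝ (Fin 3) → EuclideanSpace ℝ (Fin 3)} {t₁ : ℝ} {x₁ : EuclideanSpace ℝ (Fin 3)}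
    (hW : IsTypeIAncientMild C W)
    (hconv : ∀ s < (0 : ℝ), ∀ y : EuclideanSpace ℝ (Fin 3),
      Tendsto (fun c : ℝ => c • v (t₁ + c ^ 2 * s) (x₁ + c • y)) atTop (𝓝 (W s y))) :
    ∀ s < (0 : ℝ), ∀ y : EuclideanSpace ℝ (Fin 3),
      fderiv ℝ (W s) y y + W s y + (2 * s) • timeDeriv W s y = 0 :=
  generator_eq_zero_of_smul_apply_eq hW.contDiffOn fun _ hm _ hs y => smul_apply_of_tendsto_blowDown hconv hm hs y

end Summit.NavierStokesRegularity.NavierStokesRegularity.Theorems.SymmetryModuliCountForcedSymmetry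

end
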